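import Literature.NumberTheory.EllipticCurves.PAdicGrossZagierConstantTermProofs
import Literature.NumberTheory.EllipticCurves.BSDHeegnerPointsSignOddProofs
import HarnessLib

/-!
# Perrin-Riou's `p`-adic Gross–Zagier formula: the named fact is equivalent to its derivative
# clause (proofs companion)

Trunk T-NT-EC (Literature/NumberTheory/EllipticCurves); companion PROOF file of
`PAdicGrossZagier.lean` (named fact `Literature.NumberTheory.EllipticCurves.perrinRiou_padicGrossZagier`,
B. Perrin-Riou, *Points de Heegner et dérivées de fonctions `L` `p`-adiques*, Invent. Math. 89
(1987) 455–510, Théorème 1.3). Mathlib/Literature-only proofs; this file introduces NO named fact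
(D-0026).

**The fact and its two clauses.** `perrinRiou_padicGrossZagier` is stated under the hypotheses of
Perrin-Riou 1987, §1, read for this file from the original (GDZ scan of Invent. Math. 89):
(H.1) "`p` ne divise pas `N`" and (H.2) "l'image de `a_p(f)` par `i_p` est une unité" (p. 456),
(H.3) "`N` et `D` sont premiers entre eux" (p. 457), (H.4) "tout nombre premier `l` divisant `N`
se décompose dans `k`" (p. 460), and §1.4, p. 461: "Nous supposons que `p` ne divise pas `N`, que
`f` est ordinaire en `i_p`, que tout diviseur premier de `Np` se décompose dans `k` et que `D` est
impair" (`p` odd, Introduction p. 455; in the tree `p ≥ 5`, the range of the sigma-function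
height of `CanonicalPAdicHeight.lean`). It is the conjunction of

1. *constant term*: `L_p(E/K, 0) = 0`, and
2. *derivative*: `coeff_1 L_p(E/K, T) = 0 ↔ ⟨P_K, P_K⟩_{p,K} = 0`,

for the tree's cyclotomic `p`-adic `L`-function `L_p(E/K, T) = L_p(f, α, T) · L_p(g, α, T)`
(`padicLFunctionEK`; Perrin-Riou's (1.1), p. 459: `L_p(f, 𝒞₀)(ν) = L_p(f)(ν_ℚ) L_p(f^{(ε)})(ν_ℚ)
(Ω_f/√|D|)⁻¹` on the cyclotomic line, "par comparaison des valeurs … sur un caractère d'ordre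
fini") and THE canonical cyclotomic `p`-adic height of a Heegner point `P_K ∈ E(K)`
(**Théorème 1.3**, p. 461: "La fonction `L_p(f, 𝒞)` s'annule en `𝟙` et sa dérivée en `𝟙` dans
la direction `ρ` vaut `L'_{p,ρ}(f, 𝒞) = ∏_{𝔭∣p} (1 - 𝒞(𝔭)/α_{N𝔭}(f)) (1 - 𝒞̄(𝔭)/α_{N𝔭}(f))
⟨y_{𝒞,f}, y_{𝒞̄,f}⟩_{ρ_H} / (h u²)`", where `L'_{p,ρ}(f, 𝒞) = (d/ds) L_p(f, 𝒞)(ρ^s)|_{s=0}`;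
elliptic-curve form p. 463, for `π : X₀(N) → E` with `π(∞) = 0` and `L_p(E, 𝒞) := L_p(f, 𝒞)`:
`L'_{p,ρ}(E, 𝒞) = ∏_{𝔭∣p} (…)(…) ⟨Q^{(π)}_𝒞, Q^{(π)}_𝒞̄⟩_{ρ_H,E} / (h u² deg π)`, `⟨ , ⟩_{ρ_H,E}`
"la hauteur canonique de Schneider et Mazur–Tate sur la courbe elliptique `E`"). For the trivial
class-group character `𝒞₀` and `p = 𝔭𝔭̄` split, the Euler factor is `(1 - 1/α_p(f))⁴ ≠ 0`
(`|α_p|_∞ = √p`), `Q^{(π)}_{𝒞₀}` is the trace to `k` of the Heegner point, i.e. `P_K`, and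
`dT/ds ≠ 0` at `s = 0` for `T = ν(γ)^s - 1`; all remaining normalisation constants are non-zero
(module docstring of `PAdicGrossZagier.lean`), so clause 2 is the normalisation-free content of
the displayed formula and is implied by, never stronger than, the source.

**Clause 1 is a theorem of the tree, with no extra input**
(`constantCoeff_padicLFunctionEK_eq_zero_of_isHeegnerPoint` below). Perrin-Riou notes (p. 461):
"L'équation fonctionnelle de `L_p(f, 𝒞)` implique que `L_p(f, 𝒞)(𝟙)` est nul (il suffit
d'ailleurs que `ε(N) = 1` pour cela)". In the tree: the Heegner-point hypothesis
`IsHeegnerPoint N W K P` carries a modular parametrisation datum of level `N`, hence a newform of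
`W` at level `N = N_E` (`ModularParametrizationData.isNewformOf`); for odd `d_K` the Kronecker
character of `K` twists `E` into `E^{(d_K)}` with `χ(-1) χ(N) = -1`
(`exists_twistCharacter_of_odd_discr`; Gross 1984, §5: "`ε(N) = 1`, `ε(-1) = -1`"), so
`ord_{s=1} L(E/K, s)` is odd and `L(E/K, 1) = 0`
(`one_le_analyticRankEK_of_isNewformOf_of_cuspCoeff_twist`: Atkin–Lehner signs of `f` and of its
twist and Hecke's functional equations, proved in `BSDHeegnerPointsSignTwistProofs.lean`), and the
Mazur–Tate–Teitelbaum interpolation property at the trivial character transports `L(E/K, 1) = 0`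
to `L_p(E/K, 0) = 0` (`constantCoeff_padicLFunctionEK_eq_zero_of_analyticRankEK_ne_zero`,
`PAdicGrossZagierConstantTermProofs.lean`; Mazur–Tate–Teitelbaum 1986, §I.14 (14.3); Howard 2005,
Thm. 1 and the sentence after it: "The Heegner hypothesis forces the constant term `L_{f,0}` to
vanish"). No sign fact (`one_le_analyticRankEK`) is needed any more.

**Consequently the named fact is EQUIVALENT to its derivative clause**
(`perrinRiou_padicGrossZagier_iff_derivative`, proved with no hypothesis), and clause 2 is the
theorem proper. Its published proof is Perrin-Riou's §§2–5 (plan, §1.5 pp. 465–466): the `p`-adic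
`L`-function as a "produit de Petersson `p`-adique" of `f` with `Σ_σ 𝒞(σ) e(L'_{p,σ})`, `L'_{p,σ}` a
`p`-adic modular form of level `Np^∞` and `e` Hida's ordinary projector (§2); the `q`-expansion of
`L'_{p,σ}` (§3, Prop. 3.18); Lemme 1.10 and the decomposition `F_σ = F_{σ,fin} + F_{σ,p}` of the
generating series of `p`-adic heights `⟨T_N(m) y, y^σ⟩` into local symbols (§§4–5.1, the places
`v ∤ p` by the Gross–Zagier computations, Prop. 3.20 and (5.3)); the places `v ∣ p` via ordinary
points and quasi-canonical liftings (§§5.2–5.3); and (p. 466) "`e(T(p) - 1) ∏_{𝔭∣p} (T(p) - σ_𝔭)²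
F_{σ,p}` est une forme modulaire de niveau `Np` qui est orthogonale à `f` … Le théorème 1.3 s'en
déduit". None of these objects — `p`-adic modular forms, the ordinary projector, Rankin–Selberg
convolutions of theta and Eisenstein measures, local `p`-adic symbols on `J₀(N)`, arithmetic
intersection theory on `X₀(N)` — exists in Mathlib or in the tree (SIZE XL: a theory).

**Review of the decomposition (D-0026).** An earlier revision of this file isolated clause 2 as a
separate named fact `perrinRiou_padicGrossZagier_derivative` (same citation, Thm. 1.3), whose
prove-seat triaged it XL. By `perrinRiou_padicGrossZagier_iff_derivative` that `Prop` is
*logically equivalent* to the parent fact — a restatement, not a distinct published `M`-sized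
result — so the decomposition is MERGED back: the `def` is deleted, the parent
`perrinRiou_padicGrossZagier` (`PAdicGrossZagier.lean`) is the single named fact carrying
Perrin-Riou's theorem, and this file keeps only proved content. Guidance for later seats:
Théorème 1.3 is one theorem whose published proof is a theory; it admits no decomposition into
published sub-results statable with the tree's objects, and it should stay a trust-base named fact
until `p`-adic modular forms and `p`-adic heights on Jacobians exist in the library — do not
re-split it, and do not re-introduce its derivative clause under a new name.

**Contents (all PROVED, no hypotheses beyond those of the fact).**
* `one_le_analyticRankEK_of_isHeegnerPoint` — `L(E/K, 1) = 0` from a Heegner point of level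
  `N = N_E` and odd `d_K`;
* `constantCoeff_padicLFunctionEK_eq_zero_of_isHeegnerPoint`,
  `one_le_order_padicLFunctionEK_of_isHeegnerPoint` — clause 1;
* `order_padicLFunctionEK_eq_one_iff_coeff_one_ne_zero` — `ord_{T=0} L_p(E/K, T) = 1 ↔
  coeff_1 L_p(E/K, T) ≠ 0` under the hypotheses of the fact, so that what the route
  BirchSwinnertonDyer/PAdicOrder takes from Perrin-Riou is exactly clause 2;
* `perrinRiou_padicGrossZagier_iff_derivative` (the fact `↔` clause 2, stated inline),
  `perrinRiou_padicGrossZagier_of_derivative` (the useful direction) and the pointwise projection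
  `perrinRiou_padicGrossZagier.coeff_one_eq_zero_iff`.

**Faithfulness audit of clause 2 against the restatements that generalise it** (unchanged):
Nekovář 1995, Thm. A and Corollary (weight `2r`, `r = 1` being Perrin-Riou's case: `D` odd, all
`ℓ ∣ N` split, `p ∤ 2N` split in `K`, `f` ordinary):
`L'_p(f ⊗ K, 𝟙) = -(1 - p^{r-1}/α_p)⁴ ⟨z_{K,f}, z_{K,f}⟩_K / (u² (4|D|)^{r-1})`; Disegni 2015, Thm. B
(`F = ℚ`, all `℘ ∣ p` split): `L_p(f_E, 𝟙) = 0` and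
`L'_{p,𝒲}(f_E, 𝟙) = D_F^{-2} ∏_{℘∣p} (1 - 1/α_℘)² (1 - 1/(ε(℘)α_℘))² ⟨z_f, z_f⟩_𝒲`, with (4.4.1) the
factorisation of the cyclotomic restriction (Perrin-Riou's (1.1)). With `α ≠ 1`, the passage
`J₀(N) → E` (`deg π`, p. 463) and the `-2p` renormalisation of the Mazur–Tate = Schneider height
built into `WeierstrassCurve.PAdicHeightDataK.IsCanonical`, every constant between the printed
formula and the tree's objects is non-zero; no discrepancy with the vendored statement was found.

## References

* B. Perrin-Riou, Invent. Math. 89 (1987): §1.1 (H.1)–(H.2) p. 456, (H.3) p. 457, Thm. 1.1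
  p. 458, (1.1) p. 459; §1.2 (H.4) p. 460; §1.4 Thm. 1.3 p. 461, Cor. 1.6–1.7 p. 462,
  elliptic-curve form p. 463, Cor. 1.8–1.9 p. 464; §1.5 pp. 465–466.
* B. Howard, *The Iwasawa theoretic Gross–Zagier theorem*, Compos. Math. 141 (2005), Thm. 1.
* B. Mazur, J. Tate, J. Teitelbaum, Invent. Math. 84 (1986), §I.14 (14.3).
* B. H. Gross, *Heegner points on `X₀(N)`* (1984), §5 (sign of the functional equation).
* J. Nekovář, *On the `p`-adic height of Heegner cycles*, Math. Ann. 302 (1995), Thm. A and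
  Corollary.
* D. Disegni, *`p`-adic heights of Heegner points on Shimura curves*, Algebra Number Theory 9
  (2015) 1571–1646, Thm. B, (4.4.1).
-/

noncomputable section

open scoped MatrixGroups ModularForm
open CongruenceSubgroup NumberField Literature.NumberTheory.EllipticCurves.ModularForms

namespace Literature.NumberTheory.EllipticCurves

/-! ### Clause 1 of Théorème 1.3, proved outright -/

section ConstantTerm

variable {W : WeierstrassCurve ℚ} [W.IsElliptic] {K : Type} [Field K] [NumberField K] {N : ℕ}
  [NeZero N]

/-- **`L(E/K, 1) = 0` from a Heegner point of level `N = N_E`, for odd `d_K`** (Gross 1984, §5;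
Perrin-Riou 1987, p. 461: "il suffit d'ailleurs que `ε(N) = 1` pour cela"). The Heegner-point
hypothesis supplies a modular parametrisation datum of `W` at level `N`, hence a newform of `W` at
level `N` (`ModularParametrizationData.isNewformOf`); the Kronecker character of `K` is a primitive
quadratic character `χ` mod `|d_K|`, `(N, |d_K|) = 1`, with `aₙ(E^{(d_K)}) = χ(n) aₙ(E)` and
`χ(-1) χ(N) = -1` (`exists_twistCharacter_of_odd_discr`), so `ord_{s=1} L(E, s) L(E^{(d_K)}, s)` is
odd (`one_le_analyticRankEK_of_isNewformOf_of_cuspCoeff_twist`). [cite: Gross1984, §5] -/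
theorem one_le_analyticRankEK_of_isHeegnerPoint (hK : IsImaginaryQuadratic K)
    (hodd : Odd (NumberField.discr K)) (hN : W.conductorNorm ℤ = N)
    (hH : SatisfiesHeegnerHypothesis N K) {P : (W.baseChange K).toAffine.Point}
    (hP : IsHeegnerPoint N W K P) : 1 ≤ analyticRankEK W K := by
  obtain ⟨Dt, -, -, -⟩ := hP
  subst hN
  obtain ⟨m, _, χ, hNm, hq, hprim, hcoeff, hsign⟩ :=
    exists_twistCharacter_of_odd_discr W K hK hH hodd
  exact one_le_analyticRankEK_of_isNewformOf_of_cuspCoeff_twist W (W.conductorNorm ℤ) K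
    Dt.isNewformOf hNm hq hprim hcoeff hsign

variable [W.IsGloballyMinimal] {p : ℕ} [Fact p.Prime]
  {Nf Ng : ℕ} [NeZero Nf] [NeZero Ng] {f : CuspForm (Gamma0 Nf) 2} {g : CuspForm (Gamma0 Ng) 2}
  (hf : IsNewformOf W f) (hg : IsNewformOf (W.quadraticTwist (NumberField.discr K : ℚ)) g)

/-- **Clause 1 of Perrin-Riou's Théorème 1.3, proved: `L_p(E/K, 0) = 0`.** For `E/ℚ` with
globally minimal model `W` of conductor `N`, newform `f`, `g` the newform of `E^{(d_K)}`, a prime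
`p ≥ 5` of good ordinary reduction split in the imaginary quadratic field `K` of odd discriminant
satisfying the Heegner hypothesis for `N`, and any Heegner point `P ∈ E(K)` of level `N` (used
only through its parametrisation datum), the cyclotomic `p`-adic `L`-function
`L_p(E/K, T) = L_p(f, α, T) · L_p(g, α, T)` has constant term `0`: `L(E/K, 1) = 0`
(`one_le_analyticRankEK_of_isHeegnerPoint`) transported through the Mazur–Tate–Teitelbaum
interpolation property at the trivial character
(`constantCoeff_padicLFunctionEK_eq_zero_of_analyticRankEK_ne_zero`). Perrin-Riou 1987, Thm. 1.3,
first clause ("La fonction `L_p(f, 𝒞)` s'annule en `𝟙`", p. 461, with (1.1), p. 459); Howard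
2005, Thm. 1. [cite: PerrinRiou1987, Thm. 1.3 (p. 461) and (1.1) (p. 459)] -/
theorem constantCoeff_padicLFunctionEK_eq_zero_of_isHeegnerPoint (hp : 5 ≤ p)
    (hgood : W.HasGoodReductionAtPrime p) (hord : ¬ (p : ℤ) ∣ W.frobeniusTrace p)
    (hK : IsImaginaryQuadratic K) (hodd : Odd (NumberField.discr K)) (hN : W.conductorNorm ℤ = N)
    (hH : SatisfiesHeegnerHypothesis N K)
    (hsplit : ((Ideal.span {(p : ℤ)}).primesOver (𝓞 K)).ncard = 2)
    {P : (W.baseChange K).toAffine.Point} (hP : IsHeegnerPoint N W K P) :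
    PowerSeries.constantCoeff (padicLFunctionEK W p K hf hg) = 0 :=
  constantCoeff_padicLFunctionEK_eq_zero_of_analyticRankEK_ne_zero W p K hf hg (by omega) hgood hord
    hK.1 hsplit (by have := one_le_analyticRankEK_of_isHeegnerPoint hK hodd hN hH hP; omega)

/-- `ord_{T=0} L_p(E/K, T) ≥ 1` under the hypotheses of
`constantCoeff_padicLFunctionEK_eq_zero_of_isHeegnerPoint` (its `PowerSeries.order` form).
[cite: PerrinRiou1987, Thm. 1.3 (p. 461)] -/
theorem one_le_order_padicLFunctionEK_of_isHeegnerPoint (hp : 5 ≤ p)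
    (hgood : W.HasGoodReductionAtPrime p) (hord : ¬ (p : ℤ) ∣ W.frobeniusTrace p)
    (hK : IsImaginaryQuadratic K) (hodd : Odd (NumberField.discr K)) (hN : W.conductorNorm ℤ = N)
    (hH : SatisfiesHeegnerHypothesis N K)
    (hsplit : ((Ideal.span {(p : ℤ)}).primesOver (𝓞 K)).ncard = 2)
    {P : (W.baseChange K).toAffine.Point} (hP : IsHeegnerPoint N W K P) :
    (1 : ℕ∞) ≤ (padicLFunctionEK W p K hf hg).order := by
  refine PowerSeries.nat_le_order _ 1 fun i hi ↦ ?_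
  obtain rfl : i = 0 := by omega
  rw [PowerSeries.coeff_zero_eq_constantCoeff_apply]
  exact constantCoeff_padicLFunctionEK_eq_zero_of_isHeegnerPoint hf hg hp hgood hord hK hodd hN hH
    hsplit hP

/-- **Under the hypotheses of the fact, `ord_{T=0} L_p(E/K, T) = 1 ↔ coeff_1 L_p(E/K, T) ≠ 0`**
(PROVED, no named fact): the constant term vanishes
(`constantCoeff_padicLFunctionEK_eq_zero_of_isHeegnerPoint`), and a power series with zero
constant term has order exactly `1` iff its linear coefficient is non-zero (Mathlib
`PowerSeries.order_eq_nat`). So the comparison "`L_p(E/K, T)` has a SIMPLE zero at `T = 0`" of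
the route BirchSwinnertonDyer/PAdicOrder needs from Perrin-Riou's theorem exactly its derivative
clause. [cite: PerrinRiou1987, Thm. 1.3 (p. 461)] -/
theorem order_padicLFunctionEK_eq_one_iff_coeff_one_ne_zero (hp : 5 ≤ p)
    (hgood : W.HasGoodReductionAtPrime p) (hord : ¬ (p : ℤ) ∣ W.frobeniusTrace p)
    (hK : IsImaginaryQuadratic K) (hodd : Odd (NumberField.discr K)) (hN : W.conductorNorm ℤ = N)
    (hH : SatisfiesHeegnerHypothesis N K)
    (hsplit : ((Ideal.span {(p : ℤ)}).primesOver (𝓞 K)).ncard = 2)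
    {P : (W.baseChange K).toAffine.Point} (hP : IsHeegnerPoint N W K P) :
    (padicLFunctionEK W p K hf hg).order = 1 ↔
      PowerSeries.coeff 1 (padicLFunctionEK W p K hf hg) ≠ 0 := by
  have h0 := constantCoeff_padicLFunctionEK_eq_zero_of_isHeegnerPoint hf hg hp hgood hord hK hodd hN
    hH hsplit hP
  rw [show (1 : ℕ∞) = ((1 : ℕ) : ℕ∞) from rfl, PowerSeries.order_eq_nat]
  constructor
  · exact fun hh ↦ hh.1
  · intro hh
    refine ⟨hh, fun i hi ↦ ?_⟩
    obtain rfl : i = 0 := by omega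
    rwa [PowerSeries.coeff_zero_eq_constantCoeff_apply]

end ConstantTerm

/-! ### The named fact is equivalent to its derivative clause -/

/-- **`perrinRiou_padicGrossZagier` ↔ its derivative clause** (PROVED, no hypothesis). The
right-hand side is clause 2 alone, with the same binders as the fact: for all data as in
`perrinRiou_padicGrossZagier`, `coeff_1 L_p(E/K, T) = 0 ↔ ⟨P_K, P_K⟩_{p,K} = 0` — the
normalisation-free content of Perrin-Riou's formula `L'_{p,ρ}(E, 𝒞₀) = (1 - 1/α_p)⁴
⟨Q^{(π)}, Q^{(π)}⟩_{ρ_H,E} / (h u² deg π)` (p. 463). The constant-term clause of the fact is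
supplied by `constantCoeff_padicLFunctionEK_eq_zero_of_isHeegnerPoint`. This equivalence is the
reason the derivative clause is NOT a separate named fact of the tree (it would restate the
parent; D-0026): `perrinRiou_padicGrossZagier` is the single fact carrying Théorème 1.3.
[cite: PerrinRiou1987, Thm. 1.3 (p. 461) and p. 463] -/
theorem perrinRiou_padicGrossZagier_iff_derivative :
    perrinRiou_padicGrossZagier ↔
      ∀ (W : WeierstrassCurve ℚ) [W.IsElliptic] [W.IsGloballyMinimal] (p : ℕ) [Fact p.Prime]
        (K : Type) [Field K] [NumberField K] (N : ℕ) [NeZero N]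
        {Nf Ng : ℕ} [NeZero Nf] [NeZero Ng] {f : CuspForm (Gamma0 Nf) 2}
        {g : CuspForm (Gamma0 Ng) 2}
        (hf : IsNewformOf W f) (hg : IsNewformOf (W.quadraticTwist (NumberField.discr K : ℚ)) g),
        5 ≤ p → W.HasGoodReductionAtPrime p → ¬ (p : ℤ) ∣ W.frobeniusTrace p →
        IsImaginaryQuadratic K → Odd (NumberField.discr K) →
        IsCoprime (NumberField.discr K) (N : ℤ) → W.conductorNorm ℤ = N →
        SatisfiesHeegnerHypothesis N K → ((Ideal.span {(p : ℤ)}).primesOver (𝓞 K)).ncard = 2 →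
        ∀ (DK : WeierstrassCurve.PAdicHeightDataK W p K), DK.IsCanonical →
        ∀ (P : (W.baseChange K).toAffine.Point), IsHeegnerPoint N W K P →
          (PowerSeries.coeff 1 (padicLFunctionEK W p K hf hg) = 0 ↔ DK.height P = 0) := by
  constructor
  · intro h W _ _ p _ K _ _ N _ Nf Ng _ _ f g hf hg hp hgood hord hK hodd hcop hN hH hsplit DK hDK P
      hP
    exact (h W p K N hf hg hp hgood hord hK hodd hcop hN hH hsplit DK hDK P hP).2
  · intro h W _ _ p _ K _ _ N _ Nf Ng _ _ f g hf hg hp hgood hord hK hodd hcop hN hH hsplit DK hDK P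
      hP
    exact ⟨constantCoeff_padicLFunctionEK_eq_zero_of_isHeegnerPoint hf hg hp hgood hord hK hodd hN
      hH hsplit hP, h W p K N hf hg hp hgood hord hK hodd hcop hN hH hsplit DK hDK P hP⟩

/-- **The useful direction: the derivative clause of Théorème 1.3 implies the named fact
`perrinRiou_padicGrossZagier`** (clause 1 being the theorem
`constantCoeff_padicLFunctionEK_eq_zero_of_isHeegnerPoint`). [cite: PerrinRiou1987, Thm. 1.3 (p. 461) and p. 463] -/
theorem perrinRiou_padicGrossZagier_of_derivative
    (h : ∀ (W : WeierstrassCurve ℚ) [W.IsElliptic] [W.IsGloballyMinimal] (p : ℕ) [Fact p.Prime]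
        (K : Type) [Field K] [NumberField K] (N : ℕ) [NeZero N]
        {Nf Ng : ℕ} [NeZero Nf] [NeZero Ng] {f : CuspForm (Gamma0 Nf) 2}
        {g : CuspForm (Gamma0 Ng) 2}
        (hf : IsNewformOf W f) (hg : IsNewformOf (W.quadraticTwist (NumberField.discr K : ℚ)) g),
        5 ≤ p → W.HasGoodReductionAtPrime p → ¬ (p : ℤ) ∣ W.frobeniusTrace p →
        IsImaginaryQuadratic K → Odd (NumberField.discr K) →
        IsCoprime (NumberField.discr K) (N : ℤ) → W.conductorNorm ℤ = N →
        SatisfiesHeegnerHypothesis N K → ((Ideal.span {(p : ℤ)}).primesOver (𝓞 K)).ncard = 2 →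
        ∀ (DK : WeierstrassCurve.PAdicHeightDataK W p K), DK.IsCanonical →
        ∀ (P : (W.baseChange K).toAffine.Point), IsHeegnerPoint N W K P →
          (PowerSeries.coeff 1 (padicLFunctionEK W p K hf hg) = 0 ↔ DK.height P = 0)) :
    perrinRiou_padicGrossZagier :=
  perrinRiou_padicGrossZagier_iff_derivative.mpr h

/-- **Pointwise projection: the fact gives the derivative clause** — under the hypotheses of
`perrinRiou_padicGrossZagier`, `coeff_1 L_p(E/K, T) = 0 ↔ ⟨P_K, P_K⟩_{p,K} = 0` (Perrin-Riou 1987,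
Thm. 1.3, second clause, normalisation-free form). [cite: PerrinRiou1987, Thm. 1.3 (p. 461) and p. 463] -/
theorem perrinRiou_padicGrossZagier.coeff_one_eq_zero_iff (h : perrinRiou_padicGrossZagier)
    {W : WeierstrassCurve ℚ} [W.IsElliptic] [W.IsGloballyMinimal] {p : ℕ} [Fact p.Prime]
    {K : Type} [Field K] [NumberField K] {N : ℕ} [NeZero N]
    {Nf Ng : ℕ} [NeZero Nf] [NeZero Ng] {f : CuspForm (Gamma0 Nf) 2} {g : CuspForm (Gamma0 Ng) 2}
    (hf : IsNewformOf W f) (hg : IsNewformOf (W.quadraticTwist (NumberField.discr K : ℚ)) g)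
    (hp : 5 ≤ p) (hgood : W.HasGoodReductionAtPrime p) (hord : ¬ (p : ℤ) ∣ W.frobeniusTrace p)
    (hK : IsImaginaryQuadratic K) (hodd : Odd (NumberField.discr K))
    (hcop : IsCoprime (NumberField.discr K) (N : ℤ)) (hN : W.conductorNorm ℤ = N)
    (hH : SatisfiesHeegnerHypothesis N K)
    (hsplit : ((Ideal.span {(p : ℤ)}).primesOver (𝓞 K)).ncard = 2)
    {DK : WeierstrassCurve.PAdicHeightDataK W p K} (hDK : DK.IsCanonical)
    {P : (W.baseChange K).toAffine.Point} (hP : IsHeegnerPoint N W K P) :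
    PowerSeries.coeff 1 (padicLFunctionEK W p K hf hg) = 0 ↔ DK.height P = 0 :=
  (h W p K N hf hg hp hgood hord hK hodd hcop hN hH hsplit DK hDK P hP).2

end Literature.NumberTheory.EllipticCurves

end
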